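import Summits.CriticalPhenomena.CardyFormulaZ2.Theorems.CardyComplexConeParafermionToSLESixFamiliesDiamondDefs
import HarnessLib

/-!
# Line `potential-darboux-picard-diamond`, stub S4′ (`stub_identifyPotentialPh`): pieces of the boundary loop between consecutive subdivision points

Helper file of the stub `stub_identifyPotentialPh` of crux `ParafermionToSLESixFamilies` (stmt-CriticalPhenomena-11389).
Step (iii) of the identification subdivides the counter-clockwise boundary loop `ℓ` of a marked diamond (corners
`P k`, `ℓ ((k + r)π/2) = P k + r (P (k+1) − P k)`, `…DiamondIdentifyLoop`) at the corner and mark parameters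
(`…DiamondIdentifyEnum`). This file proves, from the loop properties taken as hypotheses, the facts about ONE piece
`[t, t′]` of the subdivision lying in a quarter period `[kπ/2, (k+1)π/2]` with no mark strictly inside:
`ℓ` is affine on it and `[ℓ t, ℓ t′]` is an ORIENTED BOUNDARY SEGMENT of `D` (`isBdrySegment_of_piece`, registered
helper of the crux item); the periodic reduction of parameters (`loop_int_periodic`, `loop_reduce`); a piece of an
increasing sequence avoiding the quarter-period grid lies in one quarter period (`piece_within_quarter`); and the two
turning computations at a subdivision point (`arg_div_of_pos_real`, `arg_div_of_pos_real_mul_I`).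
-/

noncomputable section

namespace Summit.CriticalPhenomena.CardyFormulaZ2.Cruxes.ParafermionToSLESixFamilies.PotentialDarbouxPicardDiamond

open scoped Topology ComplexConjugate
open Filter Set Metric Complex
open Literature.Probability.RandomPlanarGeometry

/-! ## Periodic reduction of parameters -/

/-- A loop with period `L` is invariant under integer translates of the period. -/
theorem loop_int_periodic {ℓ : ℝ → ℂ} {L : ℝ} (hper : ∀ s, ℓ (s + L) = ℓ s) (n : ℤ) (s : ℝ) :
    ℓ (s + n * L) = ℓ s := by
  have hnat : ∀ (m : ℕ) (s : ℝ), ℓ (s + m * L) = ℓ s := by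
    intro m
    induction m with
    | zero => intro s; simp
    | succ m ih => intro s; rw [show s + ((m + 1 : ℕ) : ℝ) * L = (s + m * L) + L by push_cast; ring, hper, ih]
  obtain ⟨m, rfl | rfl⟩ := Int.eq_nat_or_neg n
  · exact_mod_cast hnat m s
  · have := hnat m (s + ((-(m : ℤ) : ℤ) : ℝ) * L)
    rw [show s + ((-(m : ℤ) : ℤ) : ℝ) * L + m * L = s by push_cast; ring] at this
    exact this.symm

/-- Every parameter reduces to the fundamental period. -/
theorem loop_reduce {ℓ : ℝ → ℂ} {L : ℝ} (hL : 0 < L) (hper : ∀ s, ℓ (s + L) = ℓ s) (s : ℝ) :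
    ∃ s₀ : ℝ, s₀ ∈ Ico 0 L ∧ ∃ n : ℤ, s = s₀ + n * L ∧ ℓ s₀ = ℓ s := by
  refine ⟨s - ⌊s / L⌋ * L, ⟨?_, ?_⟩, ⌊s / L⌋, by ring, ?_⟩
  · have := Int.floor_le (s / L)
    rw [le_div_iff₀ hL] at this; linarith
  · have := Int.lt_floor_add_one (s / L)
    rw [div_lt_iff₀ hL] at this; linarith
  · have := loop_int_periodic hper (-⌊s / L⌋) s
    rw [show s + ((-⌊s / L⌋ : ℤ) : ℝ) * L = s - ⌊s / L⌋ * L by push_cast; ring] at this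
    exact this

/-! ## A piece lies in one quarter period -/

/-- If an increasing step `t < t′` of non-negative parameters contains no point of the grid `(π/2)ℕ` strictly inside,
then it lies in the quarter period `[kπ/2, (k+1)π/2]`, `k = ⌊t/(π/2)⌋`. -/
theorem piece_within_quarter {t t' : ℝ} (ht0 : 0 ≤ t)
    (hgap : ∀ m : ℕ, ¬ (t < m * (Real.pi / 2) ∧ m * (Real.pi / 2) < t')) :
    (⌊t / (Real.pi / 2)⌋₊ : ℝ) * (Real.pi / 2) ≤ t ∧ t' ≤ (⌊t / (Real.pi / 2)⌋₊ + 1) * (Real.pi / 2) := by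
  have hπ : 0 < Real.pi / 2 := by positivity
  have hx0 : 0 ≤ t / (Real.pi / 2) := div_nonneg ht0 hπ.le
  have h1 := Nat.floor_le hx0
  have h2 := Nat.lt_floor_add_one (t / (Real.pi / 2))
  rw [le_div_iff₀ hπ] at h1
  rw [div_lt_iff₀ hπ] at h2
  refine ⟨h1, ?_⟩
  by_contra hcon
  push Not at hcon
  exact hgap (⌊t / (Real.pi / 2)⌋₊ + 1) ⟨by exact_mod_cast h2, by exact_mod_cast hcon⟩

/-! ## Turning computations -/

/-- A quotient which is a positive real has argument `0`. -/
theorem arg_div_of_pos_real {u v : ℂ} {x : ℝ} (hx : 0 < x) (hv : v ≠ 0) (h : u = (x : ℂ) * v) : (u / v).arg = 0 := by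
  rw [h, mul_div_assoc, div_self hv, mul_one]
  exact arg_ofReal_of_nonneg hx.le

/-- A quotient which is a positive real multiple of `i` has argument `π/2`. -/
theorem arg_div_of_pos_real_mul_I {u v w : ℂ} {x ρ : ℝ} (hx : 0 < x) (hρ : 0 < ρ)
    (hw : w / v = (ρ : ℂ) * I) (h : u = (x : ℂ) * w) : (u / v).arg = Real.pi / 2 := by
  rw [h, mul_div_assoc, hw, ← mul_assoc, ← ofReal_mul, arg_real_mul _ (mul_pos hx hρ), arg_I]

/-! ## One piece of the subdivision is an oriented boundary segment -/

/-- **A piece of the boundary loop between consecutive subdivision points is an oriented boundary segment.** Let `ℓ`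
be the boundary loop of `D` (range `= frontier`, `2π`-periodic, injective on `[0, 2π)`, affine through the corners
`P k` on each quarter period, the carrier strictly to the left of each side), and `[t, t′] ⊆ [kπ/2, (k+1)π/2]` a
non-degenerate parameter interval with no mark parameter strictly inside. Then `ℓ` is affine on `[t, t′]` and
`[ℓ t, ℓ t′]` is an oriented boundary segment of `D`. -/
theorem isBdrySegment_of_piece : ∀ (D : DobrushinDomain) (ℓ : ℝ → ℂ) (P : ℕ → ℂ) (k : ℕ) (t t' : ℝ), Set.range ℓ = frontier D.carrier → (∀ k : ℕ, P k ≠ P (k + 1)) → (∀ (k : ℕ) (r : ℝ), 0 ≤ r → r ≤ 1 → ℓ ((k + r) * (Real.pi / 2)) = P k + r * (P (k + 1) - P k)) → (∀ z ∈ D.carrier, ∀ k : ℕ, 0 < ((z - P k) * (starRingEnd ℂ) (P (k + 1) - P k)).im) → (k : ℝ) * (Real.pi / 2) ≤ t → t < t' → t' ≤ (k + 1) * (Real.pi / 2) → (∀ s : ℝ, t < s → s < t' → ℓ s ≠ D.pt 0 ∧ ℓ s ≠ D.pt 1) → IsBdrySegment D (ℓ t) (ℓ t') ∧ ∀ s :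 ℝ, t ≤ s → s ≤ t' → ℓ s = ℓ t + (((s - t) / (t' - t) : ℝ) : ℂ) * (ℓ t' - ℓ t) := by
  intro D ℓ P k t t' hrange hPne hpiece hleft hkt htt' ht'k hnomark
  have hπ : 0 < Real.pi / 2 := by positivity
  -- local parameters
  have hloc : ∀ s : ℝ, (k : ℝ) * (Real.pi / 2) ≤ s → s ≤ (k + 1) * (Real.pi / 2) →
      ℓ s = P k + (((s - k * (Real.pi / 2)) / (Real.pi / 2) : ℝ) : ℂ) * (P (k + 1) - P k) := by
    intro s hs1 hs2
    have h := hpiece k ((s - k * (Real.pi / 2)) / (Real.pi / 2)) (div_nonneg (by linarith) hπ.le)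
      (by rw [div_le_one hπ]; linarith)
    rw [show ((k : ℝ) + (s - k * (Real.pi / 2)) / (Real.pi / 2)) * (Real.pi / 2) = s by field_simp; ring] at h
    exact h
  set r : ℝ := (t - k * (Real.pi / 2)) / (Real.pi / 2) with hr
  set r' : ℝ := (t' - k * (Real.pi / 2)) / (Real.pi / 2) with hr'
  have hrr' : r < r' := by rw [hr, hr']; exact div_lt_div_of_pos_right (by linarith) hπ
  have hℓt : ℓ t = P k + (r : ℂ) * (P (k + 1) - P k) := hloc t hkt (by linarith)
  have hℓt' : ℓ t' = P k + (r' : ℂ) * (P (k + 1) - P k) := hloc t' (by linarith) ht'k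
  have hdiff : ℓ t' - ℓ t = ((r' - r : ℝ) : ℂ) * (P (k + 1) - P k) := by rw [hℓt, hℓt']; push_cast; ring
  have hΔ : P (k + 1) - P k ≠ 0 := sub_ne_zero.2 (hPne k).symm
  -- affinity on the piece
  have haff : ∀ s : ℝ, t ≤ s → s ≤ t' → ℓ s = ℓ t + (((s - t) / (t' - t) : ℝ) : ℂ) * (ℓ t' - ℓ t) := by
    intro s hs1 hs2
    rw [hloc s (by linarith) (by linarith), hdiff, hℓt]
    have hne : t' - t ≠ 0 := by linarith
    have hkey : (s - k * (Real.pi / 2)) / (Real.pi / 2) = r + (s - t) / (t' - t) * (r' - r) := by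
      rw [hr, hr']; field_simp; ring
    rw [hkey]; push_cast; ring
  refine ⟨⟨?_, ?_, ?_, ?_, ?_⟩, haff⟩
  · -- non-degenerate
    rw [hℓt, hℓt']
    intro heq
    have : ((r : ℂ) - r') * (P (k + 1) - P k) = 0 := by linear_combination heq
    rcases mul_eq_zero.1 this with h | h
    · have : (r : ℂ) = r' := by linear_combination h
      have : r = r' := by exact_mod_cast this
      linarith
    · exact hΔ h
  · -- on the frontier
    rw [← hrange, segment_eq_image' ℝ]
    rintro _ ⟨θ, ⟨hθ0, hθ1⟩, rfl⟩
    refine ⟨t + θ * (t' - t), ?_⟩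
    show ℓ (t + θ * (t' - t)) = ℓ t + θ • (ℓ t' - ℓ t)
    rw [haff (t + θ * (t' - t)) (by nlinarith) (by nlinarith), real_smul]
    congr 2
    rw [show t + θ * (t' - t) - t = θ * (t' - t) by ring, mul_div_assoc, div_self (by linarith), mul_one]
  · -- the first mark is not inside
    intro hmem
    rw [openSegment_eq_image' ℝ] at hmem
    obtain ⟨θ, ⟨hθ0, hθ1⟩, hθ⟩ := hmem
    have hθ' : ℓ t + θ • (ℓ t' - ℓ t) = D.pt 0 := hθ
    have hs : ℓ (t + θ * (t' - t)) = D.pt 0 := by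
      rw [← hθ', haff (t + θ * (t' - t)) (by nlinarith) (by nlinarith), real_smul]
      congr 2
      rw [show t + θ * (t' - t) - t = θ * (t' - t) by ring, mul_div_assoc, div_self (by linarith), mul_one]
    exact (hnomark (t + θ * (t' - t)) (by nlinarith) (by nlinarith)).1 hs
  · -- the second mark is not inside
    intro hmem
    rw [openSegment_eq_image' ℝ] at hmem
    obtain ⟨θ, ⟨hθ0, hθ1⟩, hθ⟩ := hmem
    have hθ' : ℓ t + θ • (ℓ t' - ℓ t) = D.pt 1 := hθ
    have hs : ℓ (t + θ * (t' - t)) = D.pt 1 := by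
      rw [← hθ', haff (t + θ * (t' - t)) (by nlinarith) (by nlinarith), real_smul]
      congr 2
      rw [show t + θ * (t' - t) - t = θ * (t' - t) by ring, mul_div_assoc, div_self (by linarith), mul_one]
    exact (hnomark (t + θ * (t' - t)) (by nlinarith) (by nlinarith)).2 hs
  · -- the carrier is on the left
    intro z hz
    rw [hdiff, hℓt]
    have h1 : (z - (P k + (r : ℂ) * (P (k + 1) - P k))) * conj (((r' - r : ℝ) : ℂ) * (P (k + 1) - P k)) =
        ((r' - r : ℝ) : ℂ) * ((z - P k) * conj (P (k + 1) - P k)) -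
          (((r' - r) * r : ℝ) : ℂ) * ((P (k + 1) - P k) * conj (P (k + 1) - P k)) := by
      rw [map_mul, conj_ofReal]; push_cast; ring
    have h2 : (P (k + 1) - P k) * conj (P (k + 1) - P k) = (normSq (P (k + 1) - P k) : ℂ) := mul_conj _
    rw [h1, h2, sub_im, im_ofReal_mul, ← ofReal_mul, ofReal_im, sub_zero]
    exact mul_pos (by linarith) (hleft z hz k)

end Summit.CriticalPhenomena.CardyFormulaZ2.Cruxes.ParafermionToSLESixFamilies.PotentialDarbouxPicardDiamond

end
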